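import Summits.AnomalousDissipation.AnomalousDissipation.Theses.CriticalLayer
import Literature.Analysis.FluidPDE.LerayHopfGalileanTorus
import Literature.Analysis.FluidPDE.LerayHopfGalileanTorusWeak
import Literature.Analysis.FluidPDE.LerayHopfGalileanTorusTest
import Literature.Analysis.FluidPDE.LerayHopfGalileanTorusTools
import Literature.Analysis.FluidPDE.TorusWeakNSGluing
import Literature.Analysis.FluidPDE.StokesTorusProofs
import Literature.Analysis.FunctionSpaces.TorusAxisAverage
import Literature.Analysis.FunctionSpaces.TorusEnstrophyOrthogonality
import HarnessLib

/-!
# `CriticalLayer.KolmogorovObliqueThesis` from the route's three cruxes (BC2 redirect of the deciding crux)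

Support file for the deciding crux `Summit.AnomalousDissipation.AnomalousDissipation.Theses.CriticalLayer.KolmogorovObliqueThesis`
(item stmt-AnomalousDissipation-1010, Thesis X of route CriticalLayer, which the re-audit bins as RESTATED: X is at least as
strong as the summit statement).  The honest reduction is the route's own typed decomposition of X into its three genuine
cruxes, and this file PROVES that decomposition, sorry-free and with no definitions:

  `kolmogorovObliqueThesis_of_cruxes :
     TurbulentCriticalLayersAbsorb → ShearInjectionSign → NoMeanLeakage → KolmogorovObliqueThesis`

(items stmt-AnomalousDissipation-1011, -1013, -14265), together with the two support items that the route's glue item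
`CruxesGiveThesis` (stmt-AnomalousDissipation-14398) took as hypotheses — both are now theorems, so `cruxesGiveThesis`
proves item 14398 verbatim.

## Part A — space-translation covariance of torus Leray–Hopf solutions (item 14397, proved)

`isLerayHopfOn_comp_add_right`: if `u` is Leray–Hopf on `T^d × [0, T)` for `(ν, f, u₀)` then `(t, x) ↦ u t (x + a)` is
Leray–Hopf for the translated force `(t, x) ↦ f t (x + a)` and datum `x ↦ u₀ (x + a)` — field by field: the weak
formulation is tested with the transported field `ψ(t, · − a)` (a space–time test field again; the space operators of a
translate are the translates of the operators, `Torus.fderiv_comp_sub` / `laplacian_comp_sub` / `divergence_comp_sub`;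
Haar invariance of `∫` needs no integrability); measurability through the measure-preserving shear `(t, ỹ) ↦ (t, ỹ + ã)`;
every energy functional is Haar invariant; the spectral gradient norm and the `H¹` norms are translation invariant
(unimodular phases of the Fourier coefficients, `eGradNormSq_comp_add_right`, `eSobolevNorm_comp_add_right`); weak
continuity by pairing against `w(· − a)`.  `lerayHopfSpaceTranslation` is the route's support item
`LerayHopfSpaceTranslation` (stmt-AnomalousDissipation-14397).

## Part B — regularity of the force (item 1015, proved)

`F sin(2πk x₂) e₁ + G sin(2πm x₁) e₂` is the sum of the two sine Stokes modes `stokesMode (k e₂) (F e₁)`, `stokesMode (m e₁) (G e₂)`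
(`criticalLayerForce_eq`), hence smooth, divergence free (transversal amplitudes) and mean zero for ALL `F, G, k, m`
(`kolmogorovObliqueForceRegular` = item `KolmogorovObliqueForceRegular`, stmt-AnomalousDissipation-1015).

## Part C — the assembly (the glue of the route, ≈ 60 lines of proof on top of Parts A–B)

(0) SIGN NORMALISATION (`turbulentCriticalLayersAbsorb_nonneg`): if the `TurbulentCriticalLayersAbsorb` witness has `F < 0`,
shift the whole family by half a period in `x₂`, `a = e₂/(2k)`: by Part A it is again a global Leray–Hopf family, for the
force `f_{F,G,k,m}(· + a) = f_{−F,G,k,m}` (`e^{2πik(x₂+1/2k)} = −e^{2πikx₂}`, the streamwise character does not see `a`);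
mean energy and the oblique injection are unchanged (Haar).  (1) SHEAR CLAUSE: for `F > 0`, `ShearInjectionSign` with
`δ = ε/2`, eventually in `j` (index `J`); for `F = 0` the shear pairing vanishes identically.  (2) INDEX SHIFT `j ↦ j + J`.
(3) NO-LEAK CLAUSE per `j` from `NoMeanLeakage` at `(ν j, f, u₀ j, u j)` with Part B.  (4) Assemble.

References: R. Temam, *Navier–Stokes Equations* (1984), Ch. III Thm 3.1; U. Frisch, *Turbulence* (1995), §2.2 (symmetries
of NSE on the periodic box); P. Constantin, C. Foias, *Navier–Stokes Equations* (1988), Ch. 4 (4.33) (Stokes modes);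
C. R. Doering, C. Foias, J. Fluid Mech. 467 (2002) §2 (long-time averages, injection/dissipation bookkeeping).
-/

-- `Summit.<Summit>.<Problem>` is the tree's mandated summit-side namespace (CONVENTIONS §2); for this
-- single-conjunct summit the two coincide, so the duplicate is deliberate.
set_option linter.dupNamespace false

noncomputable section

open MeasureTheory Filter Set Topology Function
open scoped InnerProductSpace RealInnerProductSpace ENNReal NNReal ContDiff
open Literature.Analysis.FunctionSpaces Literature.Analysis.FunctionSpaces.Torus
open Literature.Analysis.FluidPDE Literature.Analysis.FluidPDE.Torus UnitAddTorus
open Summit.AnomalousDissipation.AnomalousDissipation.Theses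

namespace Summit.AnomalousDissipation.AnomalousDissipation.Theorems

/-! ## Part A: space translation of torus Leray–Hopf solutions -/

section Translate

variable {d : Type*} [Fintype d] [DecidableEq d]

omit [DecidableEq d] in
/-- Haar invariance of the pairing: `∫⟪v(· + a), w⟫ = ∫⟪v, w(· − a)⟫` (no integrability needed). [folklore] -/
theorem integral_inner_comp_add_right_eq (v w : UnitAddTorus d → EuclideanSpace ℝ d) (a : UnitAddTorus d) :
    ∫ y, ⟪v (y + a), w y⟫ = ∫ x, ⟪v x, w (x - a)⟫ := by
  have : (fun y => ⟪v (y + a), w y⟫) = fun y => (fun x => ⟪v x, w (x - a)⟫) (y + a) := by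
    funext y
    simp only [add_sub_cancel_right]
  rw [this]
  exact integral_add_right_eq_self (fun x => ⟪v x, w (x - a)⟫) a

omit [DecidableEq d] in
/-- Haar invariance of the work integrand: `∫⟪g(· + a), v(· + a)⟫ = ∫⟪g, v⟫`. [folklore] -/
theorem integral_inner_comp_add_right_both (g v : UnitAddTorus d → EuclideanSpace ℝ d) (a : UnitAddTorus d) :
    ∫ y, ⟪g (y + a), v (y + a)⟫ = ∫ x, ⟪g x, v x⟫ :=
  integral_add_right_eq_self (fun x => ⟪g x, v x⟫) a

omit [DecidableEq d] in
/-- Kinetic energy is translation invariant. [folklore] -/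
theorem kineticEnergy_comp_add_right (v : UnitAddTorus d → EuclideanSpace ℝ d) (a : UnitAddTorus d) :
    kineticEnergy (fun y => v (y + a)) = kineticEnergy v := by
  unfold kineticEnergy
  rw [integral_add_right_eq_self (fun x => ‖v x‖ ^ 2) a]

omit [DecidableEq d] in
/-- The `L²` (quasi)norm is translation invariant (no measurability needed). [folklore] -/
theorem eLpNorm_two_comp_add_right (v : UnitAddTorus d → EuclideanSpace ℝ d) (a : UnitAddTorus d) :
    eLpNorm (fun y => v (y + a)) 2 volume = eLpNorm v 2 volume := by
  rw [eLpNorm_eq_lintegral_rpow_enorm_toReal two_ne_zero ENNReal.ofNat_ne_top,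
    eLpNorm_eq_lintegral_rpow_enorm_toReal two_ne_zero ENNReal.ofNat_ne_top,
    lintegral_add_right_eq_self (fun x => ‖v x‖ₑ ^ (2 : ℝ≥0∞).toReal) a]

/-- **Space translates of forced weak solutions on the torus.** [folklore] -/
theorem isWeakNSSolutionForcedOn_comp_add_right {T ν : ℝ} {f : ℝ → UnitAddTorus d → EuclideanSpace ℝ d}
    {u₀ : UnitAddTorus d → EuclideanSpace ℝ d} {u : ℝ → UnitAddTorus d → EuclideanSpace ℝ d}
    (hu : IsWeakNSSolutionForcedOn T ν f u₀ u) (a : UnitAddTorus d) :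
    IsWeakNSSolutionForcedOn T ν (fun t x => f t (x + a)) (fun x => u₀ (x + a)) (fun t x => u t (x + a)) := by
  obtain ⟨a, rfl⟩ := proj_surjective a
  obtain ⟨hm, h2, hdivae, hweak⟩ := hu
  have hae2 := ae_memLp_two_slice_of_lintegral hm h2
  refine ⟨?_, ?_, ?_, fun ψ hψ hdiv => ?_⟩
  · -- measurability: the lift of the translate is the lift composed with a measure-preserving shear
    set Θ : ℝ × EuclideanSpace ℝ d → ℝ × EuclideanSpace ℝ d := fun p => (p.1, p.2 + a) with hΘ
    have h0 : MeasurePreserving Θ (volume : Measure (ℝ × EuclideanSpace ℝ d)) volume :=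
      (MeasurePreserving.id (volume : Measure ℝ)).skew_product
        (g := fun (_ : ℝ) (y : EuclideanSpace ℝ d) => y + a) (measurable_snd.add measurable_const)
        (ae_of_all _ fun _ => (measurePreserving_add_right volume a).map_eq)
    have hS : MeasurableSet (Ioo 0 T ×ˢ (univ : Set (EuclideanSpace ℝ d))) :=
      measurableSet_Ioo.prod MeasurableSet.univ
    have h1 := h0.restrict_preimage hS
    have hpre : Θ ⁻¹' (Ioo 0 T ×ˢ univ) = Ioo 0 T ×ˢ univ := by
      ext p
      simp [hΘ]
    rw [hpre] at h1
    have hg : (stLift fun t y => u t (y + proj a)) = fun p => (stLift u ∘ Θ) p := by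
      funext p
      rfl
    rw [hg]
    exact hm.comp_measurePreserving h1
  · -- square integrability (Haar invariance slice-wise)
    have e : ∀ t, ∫⁻ y, ‖u t (y + proj a)‖ₑ ^ 2 = ∫⁻ x, ‖u t x‖ₑ ^ 2 := fun t =>
      lintegral_add_right_eq_self (fun x => ‖u t x‖ₑ ^ 2) (proj a)
    calc ∫⁻ t in Ioo 0 T, ∫⁻ y, ‖u t (y + proj a)‖ₑ ^ 2 = ∫⁻ t in Ioo 0 T, ∫⁻ x, ‖u t x‖ₑ ^ 2 :=
          lintegral_congr fun t => e t
      _ < ⊤ := h2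
  · -- weak incompressibility of a.e. slice
    filter_upwards [hdivae, hae2] with t hdt ht
    simpa only [sub_zero] using
      isWeaklyDivFree_comp_add_right_sub_const hdt (ht.integrable one_le_two) (proj a) 0
  · -- the weak identity: test `u` with the transported field `ψ' t x = ψ t (x - a)`
    have hψ' : IsSpaceTimeTest T (fun s z => ψ s (z - proj a)) := by
      obtain ⟨hs, T', hT', h0⟩ := hψ
      refine ⟨?_, T', hT', fun t ht => ?_⟩
      · have hst : stLift (fun s z => ψ s (z - proj a)) =
            stLift ψ ∘ fun z : ℝ × EuclideanSpace ℝ d => (z.1, z.2 - a) := by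
          funext z
          rfl
        rw [hst]
        exact hs.comp (contDiff_fst.prodMk (contDiff_snd.sub contDiff_const))
      · funext z
        simp [h0 t ht]
    have hdiv' : IsDivFreeTest (fun s z => ψ s (z - proj a)) := fun t x => by
      rw [divergence_comp_sub]
      exact hdiv t _
    have hid := hweak _ hψ' hdiv'
    have hdt : ∀ t x, Torus.timeDeriv (fun s z => ψ s (z - proj a)) t x = Torus.timeDeriv ψ t (x - proj a) :=
      fun t x => rfl
    have hslice : ∀ t, ∫ y, (⟪u t (y + proj a), Torus.timeDeriv ψ t y⟫ +
        ⟪u t (y + proj a), Torus.convect (fun z => u t (z + proj a)) (ψ t) y⟫ +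
        ν * ⟪u t (y + proj a), Torus.laplacian (ψ t) y⟫ + ⟪f t (y + proj a), ψ t y⟫) =
        ∫ x, (⟪u t x, Torus.timeDeriv (fun s z => ψ s (z - proj a)) t x⟫ +
          ⟪u t x, Torus.convect (u t) ((fun s z => ψ s (z - proj a)) t) x⟫ +
          ν * ⟪u t x, Torus.laplacian ((fun s z => ψ s (z - proj a)) t) x⟫ +
          ⟪f t x, (fun s z => ψ s (z - proj a)) t x⟫) := by
      intro t
      rw [← integral_add_right_eq_self (fun x => ⟪u t x, Torus.timeDeriv (fun s z => ψ s (z - proj a)) t x⟫ +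
          ⟪u t x, Torus.convect (u t) ((fun s z => ψ s (z - proj a)) t) x⟫ +
          ν * ⟪u t x, Torus.laplacian ((fun s z => ψ s (z - proj a)) t) x⟫ +
          ⟪f t x, (fun s z => ψ s (z - proj a)) t x⟫) (proj a)]
      refine integral_congr_ae (ae_of_all _ fun y => ?_)
      simp only [Torus.convect, hdt, Torus.fderiv_comp_sub, Torus.laplacian_comp_sub, add_sub_cancel_right]
    have hdat : ∫ y, ⟪u₀ (y + proj a), ψ 0 y⟫ = ∫ x, ⟪u₀ x, (fun s z => ψ s (z - proj a)) 0 x⟫ :=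
      integral_inner_comp_add_right_eq u₀ (ψ 0) (proj a)
    rw [integral_congr_ae (ae_of_all _ hslice), hdat]
    exact hid

/-- **Space-translation covariance of Leray–Hopf solutions on `T^d × [0, T)`**: translating velocity, datum and
force by the same `a ∈ T^d` preserves every clause of `Torus.IsLerayHopfOn` (Temam, Ch. III Thm 3.1; folklore). [folklore] -/
theorem isLerayHopfOn_comp_add_right {T ν : ℝ} {f : ℝ → UnitAddTorus d → EuclideanSpace ℝ d}
    {u₀ : UnitAddTorus d → EuclideanSpace ℝ d} {u : ℝ → UnitAddTorus d → EuclideanSpace ℝ d}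
    (h : IsLerayHopfOn T ν f u₀ u) (a : UnitAddTorus d) :
    IsLerayHopfOn T ν (fun t x => f t (x + a)) (fun x => u₀ (x + a)) (fun t x => u t (x + a)) := by
  -- slice-wise invariances along the solution
  have hG : ∀ {s t : ℝ}, 0 ≤ s → t ≤ T →
      ∫⁻ τ in Ioo s t, eGradNormSq (fun y => u τ (y + a)) = ∫⁻ τ in Ioo s t, eGradNormSq (u τ) :=
    fun hs ht => setLIntegral_congr_fun measurableSet_Ioo fun τ hτ =>
      eGradNormSq_comp_add_right ((h.memLp τ ⟨hs.trans hτ.1.le, hτ.2.le.trans ht⟩).integrable one_le_two) a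
  have hW : ∀ s t : ℝ, ∫ τ in s..t, ∫ y, ⟪f τ (y + a), u τ (y + a)⟫ = ∫ τ in s..t, ∫ x, ⟪f τ x, u τ x⟫ :=
    fun s t => intervalIntegral.integral_congr fun τ _ => integral_inner_comp_add_right_both (f τ) (u τ) a
  refine
    { weak := isWeakNSSolutionForcedOn_comp_add_right h.weak a
      energy_bound := ?_
      memLp := fun t ht => (h.memLp t ht).comp_measurePreserving (measurePreserving_add_right volume a)
      memL2Sobolev := ?_
      energy_ineq_zero := ?_
      energy_ineq_ae := ?_
      weak_continuous := ?_
      strong_initial := ?_ }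
  · obtain ⟨C, hC⟩ := h.energy_bound
    refine ⟨C, ?_⟩
    filter_upwards [hC] with t ht
    rwa [lintegral_add_right_eq_self (fun x => ‖u t x‖ₑ ^ 2) a]
  · obtain ⟨hae, hfin⟩ := h.memL2Sobolev
    refine ⟨?_, ?_⟩
    · filter_upwards [hae] with t ht
      exact memSobolev_comp_add_right ht a
    · have e : ∀ t, eSobolevNorm 1 (EuclideanSpace.complexify ∘ fun x => u t (x + a)) =
          eSobolevNorm 1 (EuclideanSpace.complexify ∘ u t) := fun t =>
        eSobolevNorm_comp_add_right 1 (EuclideanSpace.complexify ∘ u t) a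
      unfold eL2SobolevNorm at hfin ⊢
      simp_rw [e]
      exact hfin
  · intro t ht
    have hE := h.energy_ineq_zero t ht
    rw [kineticEnergy_comp_add_right (u t) a, kineticEnergy_comp_add_right u₀ a, hG le_rfl ht.2, hW]
    exact hE
  · filter_upwards [h.energy_ineq_ae, ae_restrict_mem measurableSet_Ioo] with s hs hsI t hst
    have hE := hs t hst
    rw [kineticEnergy_comp_add_right (u t) a, kineticEnergy_comp_add_right (u s) a, hG hsI.1.le hst.2, hW]
    exact hE
  · intro w hw
    have hws : MemLp (fun x => w (x - a)) 2 volume :=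
      hw.comp_measurePreserving (measurePreserving_sub_right volume a)
    obtain ⟨hc, hlim⟩ := h.weak_continuous _ hws
    refine ⟨?_, ?_⟩
    · simpa only [integral_inner_comp_add_right_eq _ w a] using hc
    · simpa only [integral_inner_comp_add_right_eq _ w a] using hlim
  · have e : ∀ t, eLpNorm ((fun x => u t (x + a)) - fun x => u₀ (x + a)) 2 volume = eLpNorm (u t - u₀) 2 volume :=
      fun t => eLpNorm_two_comp_add_right (u t - u₀) a
    simp_rw [e]
    exact h.strong_initial

/-- Global version. [folklore] -/
theorem isGlobalLerayHopf_comp_add_right {ν : ℝ} {f : ℝ → UnitAddTorus d → EuclideanSpace ℝ d}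
    {u₀ : UnitAddTorus d → EuclideanSpace ℝ d} {u : ℝ → UnitAddTorus d → EuclideanSpace ℝ d}
    (h : IsGlobalLerayHopf ν f u₀ u) (a : UnitAddTorus d) :
    IsGlobalLerayHopf ν (fun t x => f t (x + a)) (fun x => u₀ (x + a)) (fun t x => u t (x + a)) :=
  fun T hT => isLerayHopfOn_comp_add_right (h T hT) a

end Translate

/-- **The route's support item `LerayHopfSpaceTranslation` (stmt-AnomalousDissipation-14397) holds.** [folklore] -/
theorem lerayHopfSpaceTranslation : CriticalLayer.LerayHopfSpaceTranslation :=
  fun _T _ν _f _u₀ _u a h => isLerayHopfOn_comp_add_right h a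


/-! ## Part B: regularity of the Kolmogorov + oblique force -/

section Force

/-- Sums of smooth divergence-free fields on `T³` are divergence free. [folklore] -/
theorem isDivFree_add_of_isSmooth {f g : UnitAddTorus (Fin 3) → EuclideanSpace ℝ (Fin 3)}
    (hf : IsSmooth f) (hg : IsSmooth g) (hdf : IsDivFree f) (hdg : IsDivFree g) :
    IsDivFree (f + g) := by
  intro x
  have h1 : IsContDiff 1 f := hf.isContDiff (by simp)
  have h2 : IsContDiff 1 g := hg.isContDiff (by simp)
  have ef := hdf x
  have eg := hdg x
  rw [divergence_eq_sum_partialDeriv_apply h1] at ef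
  rw [divergence_eq_sum_partialDeriv_apply h2] at eg
  rw [divergence_eq_sum_partialDeriv_apply (h1.add h2)]
  simp only [partialDeriv_add h1 h2, Pi.add_apply, PiLp.add_apply, Finset.sum_add_distrib, ef, eg,
    add_zero]

/-- A sine Stokes mode at an axis frequency `n eᵢ`, `n : ℕ`, has zero mean (also for `n = 0`, when it vanishes). [folklore] -/
theorem hasZeroMean_stokesMode_single_nat (i : Fin 3) (n : ℕ) (a : EuclideanSpace ℝ (Fin 3)) :
    HasZeroMean ⇑(stokesMode (Pi.single i (n : ℤ)) a false) := by
  by_cases hn : n = 0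
  · subst hn
    unfold HasZeroMean
    have h0 : ∀ x : UnitAddTorus (Fin 3), stokesMode (Pi.single i ((0 : ℕ) : ℤ)) a false x = 0 := fun x => by
      rw [stokesMode_apply, Nat.cast_zero, Pi.single_zero, mFourier_zero]
      simp
    simp_rw [h0, integral_zero]
  · refine hasZeroMean_stokesMode (fun h => hn ?_) a false
    have := congrFun h i
    simpa using this

/-- The two-mode force of route CriticalLayer is a sum of two sine Stokes modes. [folklore] -/
theorem criticalLayerForce_eq (F G : ℝ) (k m : ℕ) :
    (fun x : UnitAddTorus (Fin 3) => (F * (UnitAddTorus.mFourier (Pi.single (1 : Fin 3) (k : ℤ)) x).im) • (EuclideanSpace.single (0 : Fin 3) (1 : ℝ) : EuclideanSpace ℝ (Fin 3)) + (G * (UnitAddTorus.mFourier (Pi.single (0 : Fin 3) (m : ℤ)) x).im) • (EuclideanSpace.single (1 : Fin 3) (1 : ℝ) : EuclideanSpace ℝ (Fin 3))) =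
      ⇑(stokesMode (Pi.single (1 : Fin 3) (k : ℤ)) (F • EuclideanSpace.single (0 : Fin 3) (1 : ℝ)) false) +
        ⇑(stokesMode (Pi.single (0 : Fin 3) (m : ℤ)) (G • EuclideanSpace.single (1 : Fin 3) (1 : ℝ)) false) := by
  funext x
  simp only [Pi.add_apply, stokesMode_apply, Bool.false_eq_true, if_false, smul_smul, mul_comm F, mul_comm G]

/-- **The route's support item `KolmogorovObliqueForceRegular` (stmt-AnomalousDissipation-1015) holds**: the force
`F sin(2πk x₂) e₁ + G sin(2πm x₁) e₂` is smooth, divergence free and mean zero for all `F, G, k, m`. [folklore] -/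
theorem kolmogorovObliqueForceRegular : CriticalLayer.KolmogorovObliqueForceRegular := by
  intro F G k m
  rw [criticalLayerForce_eq]
  have hs₁ := isSmooth_stokesMode (Pi.single (1 : Fin 3) (k : ℤ)) (F • EuclideanSpace.single (0 : Fin 3) (1 : ℝ)) false
  have hs₂ := isSmooth_stokesMode (Pi.single (0 : Fin 3) (m : ℤ)) (G • EuclideanSpace.single (1 : Fin 3) (1 : ℝ)) false
  have ht₁ : ⟪latticeVec (Pi.single (1 : Fin 3) (k : ℤ)), F • EuclideanSpace.single (0 : Fin 3) (1 : ℝ)⟫ = 0 := by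
    rw [← sum_intCast_mul_eq_inner_latticeVec, Fin.sum_univ_three]
    simp
  have ht₂ : ⟪latticeVec (Pi.single (0 : Fin 3) (m : ℤ)), G • EuclideanSpace.single (1 : Fin 3) (1 : ℝ)⟫ = 0 := by
    rw [← sum_intCast_mul_eq_inner_latticeVec, Fin.sum_univ_three]
    simp
  refine ⟨hs₁.add hs₂, isDivFree_add_of_isSmooth hs₁ hs₂ (isDivFree_stokesMode ht₁ false) (isDivFree_stokesMode ht₂ false), ?_⟩
  unfold HasZeroMean
  rw [integral_add' hs₁.integrable hs₂.integrable]
  rw [show (∫ x, stokesMode (Pi.single (1 : Fin 3) (k : ℤ)) (F • EuclideanSpace.single (0 : Fin 3) (1 : ℝ)) false x) = 0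
      from hasZeroMean_stokesMode_single_nat 1 k _,
    show (∫ x, stokesMode (Pi.single (0 : Fin 3) (m : ℤ)) (G • EuclideanSpace.single (1 : Fin 3) (1 : ℝ)) false x) = 0
      from hasZeroMean_stokesMode_single_nat 0 m _, add_zero]

end Force

/-! ## Part C: the cruxes give Thesis X -/

section Glue

local notation "𝕋³" => UnitAddTorus (Fin 3)
local notation "E³" => EuclideanSpace ℝ (Fin 3)

/-- Long-time means are blind to space translation: `meanEnergy` of a translate. [folklore] -/
theorem meanEnergy_comp_add_right (u : ℝ → 𝕋³ → E³) (a : 𝕋³) :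
    meanEnergy (fun t x => u t (x + a)) = meanEnergy u := by
  simp only [meanEnergy, meanSqVelocity]
  congr 1
  funext t
  exact integral_add_right_eq_self (fun x => ‖u t x‖ ^ 2) a

/-- `liminf` of the time means of the zero signal is `0`. [folklore] -/
theorem longTimeAvgInf_fun_zero : longTimeAvgInf (fun _ : ℝ => (0 : ℝ)) = 0 := by
  simp [longTimeAvgInf, Filter.liminf_const]

/-- The streamwise character `e^{2πi m x₁}` does not see a shift along `x₂`. [folklore] -/
theorem mFourier_single_zero_add_single_one (m : ℤ) (s : UnitAddCircle) (x : 𝕋³) :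
    mFourier (Pi.single (0 : Fin 3) m) (x + Pi.single (1 : Fin 3) s) = mFourier (Pi.single (0 : Fin 3) m) x := by
  rw [mFourier_add_single, Pi.single_eq_of_ne (by decide : (1 : Fin 3) ≠ 0), fourier_zero, one_mul]

/-- The half-period shift `x₂ ↦ x₂ + 1/(2k)` flips the shear character `e^{2πi k x₂}`. [folklore] -/
theorem mFourier_single_one_add_half {k : ℕ} (hk : 0 < k) (x : 𝕋³) :
    mFourier (Pi.single (1 : Fin 3) (k : ℤ)) (x + Pi.single (1 : Fin 3) (((1 : ℝ) / (2 * k) : ℝ) : UnitAddCircle)) =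
      -mFourier (Pi.single (1 : Fin 3) (k : ℤ)) x := by
  rw [mFourier_add_single, Pi.single_eq_same, fourier_coe_apply]
  have hk' : (k : ℂ) ≠ 0 := Nat.cast_ne_zero.2 hk.ne'
  have : (2 * Real.pi * Complex.I * ((k : ℤ) : ℂ) * (((1 : ℝ) / (2 * k) : ℝ) : ℂ) / ((1 : ℝ) : ℂ) : ℂ) =
      Real.pi * Complex.I := by
    push_cast
    field_simp
  rw [this, Complex.exp_pi_mul_I, neg_one_mul]

/-- The force after the half-period shift: `f_{F,G,k,m}(x + e₂/(2k)) = f_{−F,G,k,m}(x)`. [folklore] -/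
theorem criticalLayerForce_add_half {k : ℕ} (hk : 0 < k) (F G : ℝ) (m : ℕ) (x : 𝕋³) :
    (F * (UnitAddTorus.mFourier (Pi.single (1 : Fin 3) (k : ℤ)) (x + Pi.single (1 : Fin 3) (((1 : ℝ) / (2 * k) : ℝ) : UnitAddCircle))).im) • (EuclideanSpace.single (0 : Fin 3) (1 : ℝ) : E³) +
      (G * (UnitAddTorus.mFourier (Pi.single (0 : Fin 3) (m : ℤ)) (x + Pi.single (1 : Fin 3) (((1 : ℝ) / (2 * k) : ℝ) : UnitAddCircle))).im) • (EuclideanSpace.single (1 : Fin 3) (1 : ℝ) : E³) =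
    ((-F) * (UnitAddTorus.mFourier (Pi.single (1 : Fin 3) (k : ℤ)) x).im) • (EuclideanSpace.single (0 : Fin 3) (1 : ℝ) : E³) +
      (G * (UnitAddTorus.mFourier (Pi.single (0 : Fin 3) (m : ℤ)) x).im) • (EuclideanSpace.single (1 : Fin 3) (1 : ℝ) : E³) := by
  rw [mFourier_single_one_add_half hk, mFourier_single_zero_add_single_one, Complex.neg_im, mul_neg, neg_mul]

/-- The oblique pairing does not see a shift of the velocity along `x₂` (shift the character too, then Haar). [folklore] -/
theorem obliquePairing_comp_add_single_one (G : ℝ) (m : ℕ) (s : UnitAddCircle) (v : 𝕋³ → E³) :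
    ∫ x, ⟪(fun x : 𝕋³ => (G * (UnitAddTorus.mFourier (Pi.single (0 : Fin 3) (m : ℤ)) x).im) • (EuclideanSpace.single (1 : Fin 3) (1 : ℝ) : E³)) x, v (x + Pi.single (1 : Fin 3) s)⟫ =
      ∫ x, ⟪(fun x : 𝕋³ => (G * (UnitAddTorus.mFourier (Pi.single (0 : Fin 3) (m : ℤ)) x).im) • (EuclideanSpace.single (1 : Fin 3) (1 : ℝ) : E³)) x, v x⟫ := by
  rw [← integral_add_right_eq_self (fun x => ⟪(fun x : 𝕋³ => (G * (UnitAddTorus.mFourier (Pi.single (0 : Fin 3) (m : ℤ)) x).im) • (EuclideanSpace.single (1 : Fin 3) (1 : ℝ) : E³)) x, v x⟫) (Pi.single (1 : Fin 3) s)]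
  refine integral_congr_ae (ae_of_all _ fun x => ?_)
  simp only [mFourier_single_zero_add_single_one]

/-- Transport of the Leray–Hopf clause under the half-period shift `a = e₂/(2k)`: the shifted family solves the
equations with the sign of `F` flipped. [folklore] -/
theorem isGlobalLerayHopf_halfPeriodShift {F G : ℝ} {k m : ℕ} (hk : 0 < k) {ν : ℝ} {U₀ : 𝕋³ → E³} {U : ℝ → 𝕋³ → E³}
    (h : IsGlobalLerayHopf ν (fun _ => (fun x : 𝕋³ => (F * (UnitAddTorus.mFourier (Pi.single (1 : Fin 3) (k : ℤ)) x).im) • (EuclideanSpace.single (0 : Fin 3) (1 : ℝ) : E³) + (G * (UnitAddTorus.mFourier (Pi.single (0 : Fin 3) (m : ℤ)) x).im) • (EuclideanSpace.single (1 : Fin 3) (1 : ℝ) : E³))) U₀ U) :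
    IsGlobalLerayHopf ν (fun _ => (fun x : 𝕋³ => (-F * (UnitAddTorus.mFourier (Pi.single (1 : Fin 3) (k : ℤ)) x).im) • (EuclideanSpace.single (0 : Fin 3) (1 : ℝ) : E³) + (G * (UnitAddTorus.mFourier (Pi.single (0 : Fin 3) (m : ℤ)) x).im) • (EuclideanSpace.single (1 : Fin 3) (1 : ℝ) : E³)))
      (fun x => U₀ (x + Pi.single (1 : Fin 3) (((1 : ℝ) / (2 * k) : ℝ) : UnitAddCircle)))
      (fun t x => U t (x + Pi.single (1 : Fin 3) (((1 : ℝ) / (2 * k) : ℝ) : UnitAddCircle))) := by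
  have h1 := isGlobalLerayHopf_comp_add_right h (Pi.single (1 : Fin 3) (((1 : ℝ) / (2 * k) : ℝ) : UnitAddCircle))
  have key : ∀ (f g : ℝ → 𝕋³ → E³) (V₀ : 𝕋³ → E³) (V : ℝ → 𝕋³ → E³), (∀ t x, f t x = g t x) →
      IsGlobalLerayHopf ν f V₀ V → IsGlobalLerayHopf ν g V₀ V := fun f g V₀ V hfg h => by
    have e : f = g := funext fun t => funext fun x => hfg t x
    exact e ▸ h
  exact key _ _ _ _ (fun t x => criticalLayerForce_add_half hk F G m x) h1

/-- Transport of a uniform mean-energy bound under a space shift of the whole family. [folklore] -/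
theorem meanEnergy_family_shift (a : 𝕋³) {u : ℕ → ℝ → 𝕋³ → E³} (h : ∃ E : ℝ, ∀ j, meanEnergy (u j) ≤ E) :
    ∃ E : ℝ, ∀ j, meanEnergy (fun t x => u j t (x + a)) ≤ E := by
  obtain ⟨E, hE⟩ := h
  exact ⟨E, fun j => by rw [meanEnergy_comp_add_right]; exact hE j⟩

/-- Transport of the oblique injection floor under a shift of the family along `x₂`. [folklore] -/
theorem obliqueFloor_family_shift (s : UnitAddCircle) {G : ℝ} {m : ℕ} {ε : ℝ} {u : ℕ → ℝ → 𝕋³ → E³}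
    (h : ∀ j, ε ≤ longTimeAvgSup (fun t => ∫ x, ⟪(fun x : 𝕋³ => (G * (UnitAddTorus.mFourier (Pi.single (0 : Fin 3) (m : ℤ)) x).im) • (EuclideanSpace.single (1 : Fin 3) (1 : ℝ) : E³)) x, u j t x⟫)) :
    ∀ j, ε ≤ longTimeAvgSup (fun t => ∫ x, ⟪(fun x : 𝕋³ => (G * (UnitAddTorus.mFourier (Pi.single (0 : Fin 3) (m : ℤ)) x).im) • (EuclideanSpace.single (1 : Fin 3) (1 : ℝ) : E³)) x, u j t (x + Pi.single (1 : Fin 3) s)⟫) := by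
  intro j
  have e : (fun t => ∫ x, ⟪(fun x : 𝕋³ => (G * (UnitAddTorus.mFourier (Pi.single (0 : Fin 3) (m : ℤ)) x).im) • (EuclideanSpace.single (1 : Fin 3) (1 : ℝ) : E³)) x, u j t (x + Pi.single (1 : Fin 3) s)⟫) =
      fun t => ∫ x, ⟪(fun x : 𝕋³ => (G * (UnitAddTorus.mFourier (Pi.single (0 : Fin 3) (m : ℤ)) x).im) • (EuclideanSpace.single (1 : Fin 3) (1 : ℝ) : E³)) x, u j t x⟫ :=
    funext fun t => obliquePairing_comp_add_single_one G m s (u j t)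
  rw [e]
  exact h j

/-- **Sign normalisation of the `TurbulentCriticalLayersAbsorb` witness** (`0 ≤ F` without loss): if `F < 0`, translate
the whole family by half a period in `x₂` (`isGlobalLerayHopf_comp_add_right`); the force becomes `f_{−F,G,k,m}`, mean energy
and the oblique injection are unchanged. [folklore] -/
theorem turbulentCriticalLayersAbsorb_nonneg (h : CriticalLayer.TurbulentCriticalLayersAbsorb) :
    ∃ (F G : ℝ) (k m : ℕ) (ν : ℕ → ℝ) (u₀ : ℕ → 𝕋³ → E³) (u : ℕ → ℝ → 𝕋³ → E³), 0 ≤ F ∧ 0 < k ∧ 0 < m ∧ (∀ j, 0 < ν j) ∧ Filter.Tendsto ν Filter.atTop (nhds 0) ∧ (∀ j, IsGlobalLerayHopf (ν j) (fun _ => (fun x : 𝕋³ => (F * (UnitAddTorus.mFourier (Pi.single (1 : Fin 3) (k : ℤ)) x).im) • (EuclideanSpace.single (0 : Fin 3) (1 : ℝ) : E³) + (G * (UnitAddTorus.mFourier (Pi.single (0 : Fin 3) (m : ℤ)) x).im) • (EuclideanSpace.single (1 : Fin 3) (1 : ℝ) : E³))) (u₀ j) (u j)) ∧ (∃ E : ℝ,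 ∀ j, meanEnergy (u j) ≤ E) ∧ ∃ ε : ℝ, 0 < ε ∧ ∀ j, ε ≤ longTimeAvgSup (fun t => ∫ x, ⟪(fun x : 𝕋³ => (G * (UnitAddTorus.mFourier (Pi.single (0 : Fin 3) (m : ℤ)) x).im) • (EuclideanSpace.single (1 : Fin 3) (1 : ℝ) : E³)) x, u j t x⟫) := by
  obtain ⟨F, G, k, m, ν, u₀, u, hk, hm, hν, hν0, hLH, hE, ε, hε, hfloor⟩ := h
  rcases le_or_gt 0 F with hF | hF
  · exact ⟨F, G, k, m, ν, u₀, u, hF, hk, hm, hν, hν0, hLH, hE, ε, hε, hfloor⟩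
  · exact ⟨-F, G, k, m, ν, _, _, by linarith, hk, hm, hν, hν0, fun j => isGlobalLerayHopf_halfPeriodShift hk (hLH j),
      meanEnergy_family_shift _ hE, ε, hε, obliqueFloor_family_shift _ hfloor⟩

/-- **BC2 redirect — the assembly of the deciding crux from the route's three cruxes.**
`TurbulentCriticalLayersAbsorb → ShearInjectionSign → NoMeanLeakage → KolmogorovObliqueThesis`:
(0) normalise the sign of `F` in the `TurbulentCriticalLayersAbsorb` witness by the half-period shift (Part A);
(1) the shear clause (iv): for `F > 0`, `ShearInjectionSign` with `δ = ε/2` eventually in `j` (index `J`); for `F = 0` the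
shear pairing vanishes identically; (2) shift the family `j ↦ j + J`; (3) the no-leak clause (ii) per `j` from `NoMeanLeakage`
at `(ν j, f, u₀ j, u j)` and the force regularity (Part B); (4) assemble. [folklore] -/
theorem kolmogorovObliqueThesis_of_cruxes (h₁ : CriticalLayer.TurbulentCriticalLayersAbsorb)
    (h₂ : CriticalLayer.ShearInjectionSign) (h₃ : CriticalLayer.NoMeanLeakage) : CriticalLayer.KolmogorovObliqueThesis := by
  obtain ⟨F, G, k, m, ν, u₀, u, hF, hk, hm, hν, hν0, hLH, ⟨E, hE⟩, ε, hε, hfloor⟩ := turbulentCriticalLayersAbsorb_nonneg h₁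
  -- (1) the shear channel is not a brake, eventually in `j`
  have hshear : ∃ J : ℕ, ∀ j, J ≤ j → -(ε / 2) ≤ longTimeAvgInf (fun t => ∫ x, ⟪(fun x : 𝕋³ => (F * (UnitAddTorus.mFourier (Pi.single (1 : Fin 3) (k : ℤ)) x).im) • (EuclideanSpace.single (0 : Fin 3) (1 : ℝ) : E³)) x, u j t x⟫) := by
    rcases hF.eq_or_lt with hF0 | hFpos
    · subst hF0
      refine ⟨0, fun j _ => ?_⟩
      have e : (fun t => ∫ x, ⟪(fun x : 𝕋³ => ((0 : ℝ) * (UnitAddTorus.mFourier (Pi.single (1 : Fin 3) (k : ℤ)) x).im) • (EuclideanSpace.single (0 : Fin 3) (1 : ℝ) : E³)) x, u j t x⟫) = fun _ => (0 : ℝ) := by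
        funext t
        simp
      rw [e, longTimeAvgInf_fun_zero]
      linarith
    · obtain ⟨J, hJ⟩ := Filter.eventually_atTop.1 (h₂ F G k m ν u₀ u hFpos hk hm hν hν0 hLH ⟨E, hE⟩ (ε / 2) (half_pos hε))
      exact ⟨J, hJ⟩
  obtain ⟨J, hJ⟩ := hshear
  -- (3) force regularity, for the no-leak clause
  obtain ⟨hfs, hfd, hf0⟩ := kolmogorovObliqueForceRegular F G k m
  -- (2)+(4) index shift and assembly
  unfold CriticalLayer.KolmogorovObliqueThesis
  exact ⟨F, G, k, m, fun j => ν (j + J), fun j => u₀ (j + J), fun j => u (j + J), hk, hm, fun j => hν _,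
    hν0.comp (tendsto_add_atTop_nat J), fun j => hLH _, ⟨E, fun j => hE _⟩,
    fun j => h₃ _ _ _ _ (hν _) hfs hfd hf0 (hLH _), ε, hε, fun j => hfloor _, fun j => hJ _ (Nat.le_add_left J j)⟩

/-- The same assembly in the exact shape of the route's glue item `CruxesGiveThesis` (stmt-AnomalousDissipation-14398):
the two support hypotheses are now theorems (`kolmogorovObliqueForceRegular`, `lerayHopfSpaceTranslation`) and are not used. [folklore] -/
theorem cruxesGiveThesis : CriticalLayer.CruxesGiveThesis :=
  fun h₁ h₂ h₃ _ _ => kolmogorovObliqueThesis_of_cruxes h₁ h₂ h₃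

end Glue

end Summit.AnomalousDissipation.AnomalousDissipation.Theorems

end
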